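import Mathlib
import Summits.MatrixMultiplication.MatrixMultiplication.Theorems.SnSubsetDichotomyPolynomialSlackLevelOnePinning
import Summits.MatrixMultiplication.MatrixMultiplication.Theorems.SnSubsetDichotomyPolynomialSlackMarginals
import Summits.MatrixMultiplication.MatrixMultiplication.Theorems.SnSubsetDichotomyPolynomialSlackPositivity
import Summits.MatrixMultiplication.MatrixMultiplication.Theorems.SnSubsetDichotomyPolynomialSlackSpreadLevelOne
import Summits.MatrixMultiplication.MatrixMultiplication.Theorems.SnSubsetDichotomyPolynomialSlackStubSplit

/-!
# Level-one-spread TPP triples are below the first window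

Crux `Summit.MatrixMultiplication.MatrixMultiplication.Theses.SnSubsetDichotomy.PolynomialSlack`
(item `stmt-MatrixMultiplication-8306`), level-one programme, lead c3 (crux notes §E.4): the SPREAD half of the
level-one dichotomy. For a parity-pure TPP triple `S, T, U ⊆ S_n` (`n ≥ 40`) with `N = |S||T||U|` whose three
pair marginals are `λ`-SPREAD (`m_{XY}(i,j) ≤ λ|X||Y|/n` for all `i, j`, `λ ≥ 1`: no point cell of a quotient set
carries more than `λ` times its share), the pinning `levelOnePinning`, the centring identity
`centered_tripleSum_eq`, the Frobenius bound `tripleSum_le_norms` (`-Σxyz ≤ ‖x‖‖y‖‖z‖`) and the two-sided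
level-one inequality for spread sets `spread_level_one` (`‖x‖² ≤ 100·λ·L_α/n`, `L_α = (1+log n)·log(4n·n!/α)`)
give

  `2N − 2(n−1)·N·(100λ/n)·√(100λ/n)·√(L_α·L_β·L_γ) ≤ n! + n!·√(n!)/√D`,  `D = n(n−1)/6`   (`spreadTriple_nearWall`).

So if `4(n−1)(100λ)^{3/2}√(L_αL_βL_γ) ≤ n^{3/2}` — e.g. all three quotients `(n^{1/3}/polylog)`-spread —
then `N ≤ n! + n!^{3/2}/√D ≤ n! + 2.6·n!^{3/2}/n`: slack `≈ n/2.6`, the crux inequality for every `C < 1`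
eventually. Together with `cylinderMember_slack` (a level-one-flat point-cylinder member also forces every
`C < 1`) the two EXTREMES of the level-one dichotomy are closed below exponent one; what remains are triples with
a point excess `λ ∈ [n^{1/3}/polylog, n]` in some quotient that is not a flat cylinder of a member.
-/

namespace Summit.MatrixMultiplication.MatrixMultiplication.Theorems.PolynomialSlack

open scoped BigOperators
open Literature.Combinatorics.Additive (TripleProductProperty)

set_option linter.dupNamespace false

/-- Centred normalised pair marginals of a `λ`-spread unique-quotient pair: the two-sided level-one bound
`Σ(m/α - 1/n)² ≤ 100·(1+log n)·λ·log(4n·n!/α)/n` (`spread_level_one` on the quotient set). [folklore] -/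
theorem sumSq_centered_pair_le_spread {n : ℕ} (hn : 1 ≤ n) {X Y : Finset (Equiv.Perm (Fin n))}
    (hX : X.Nonempty) (hY : Y.Nonempty)
    (hinj : Set.InjOn (fun xy : Equiv.Perm (Fin n) × Equiv.Perm (Fin n) => xy.1⁻¹ * xy.2)
      (↑X ×ˢ ↑Y : Set (Equiv.Perm (Fin n) × Equiv.Perm (Fin n))))
    (lam : ℝ) (hlam : 1 ≤ lam)
    (hspread : ∀ i j : Fin n, (((X ×ˢ Y).filter fun xy => xy.2 j = xy.1 i).card : ℝ) ≤
      lam * (X.card * Y.card : ℕ) / n) :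
    ∑ i : Fin n, ∑ j : Fin n,
        ((((X ×ˢ Y).filter fun xy => xy.2 j = xy.1 i).card : ℝ) / (X.card * Y.card : ℕ) - 1 / n) ^ 2 ≤
      100 * (1 + Real.log n) * lam * Real.log (4 * n * n.factorial / (X.card * Y.card : ℕ)) / n := by
  classical
  set A := Finset.image₂ (fun x y : Equiv.Perm (Fin n) => x⁻¹ * y) X Y with hA
  have hAcard : A.card = X.card * Y.card := card_image₂_of_injOn' hinj
  have hAne : A.Nonempty := by
    rw [← Finset.card_pos, hAcard]; exact Nat.mul_pos hX.card_pos hY.card_pos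
  have hα0 : (0 : ℝ) < (X.card * Y.card : ℕ) := by exact_mod_cast Nat.mul_pos hX.card_pos hY.card_pos
  have hm : ∀ i j : Fin n, (((X ×ˢ Y).filter fun xy => xy.2 j = xy.1 i).card : ℝ) =
      ((A.filter fun a => a j = i).card : ℝ) := fun i j => by
    rw [hA]; exact_mod_cast pairMarginal_eq_marginal_image₂ hinj i j
  have hAcardR : (A.card : ℝ) = (X.card * Y.card : ℕ) := by rw [hAcard]
  have hspreadA : ∀ i j : Fin n, ((A.filter fun a => a j = i).card : ℝ) ≤ lam * A.card / n := by
    intro i j; rw [← hm, hAcardR]; exact hspread i j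
  have h := spread_level_one hn A hAne lam hlam hspreadA
  rw [hAcardR] at h
  -- divide by `α²`
  have hcell : ∀ i j : Fin n,
      ((((X ×ˢ Y).filter fun xy => xy.2 j = xy.1 i).card : ℝ) / (X.card * Y.card : ℕ) - 1 / n) ^ 2 =
        (((A.filter fun a => a j = i).card : ℝ) - ((X.card * Y.card : ℕ) : ℝ) / n) ^ 2 /
          ((X.card * Y.card : ℕ) : ℝ) ^ 2 := fun i j => by
    rw [hm]; field_simp
  simp_rw [hcell, ← Finset.sum_div]
  rw [div_le_iff₀ (by positivity)]
  calc ∑ i : Fin n, ∑ j : Fin n, (((A.filter fun a => a j = i).card : ℝ) - ((X.card * Y.card : ℕ) : ℝ) / n) ^ 2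
      ≤ 100 * (1 + Real.log n) * lam * (((X.card * Y.card : ℕ) : ℝ) ^ 2 / n) *
          Real.log (4 * n * n.factorial / (X.card * Y.card : ℕ)) := h
    _ = 100 * (1 + Real.log n) * lam * Real.log (4 * n * n.factorial / (X.card * Y.card : ℕ)) / n *
          ((X.card * Y.card : ℕ) : ℝ) ^ 2 := by ring

set_option maxHeartbeats 800000 in
/-- **Spread triples near the wall.** For `n ≥ 40`, a parity-pure TPP triple `S, T, U ⊆ S_n` and `λ ≥ 1`
such that all three pair marginals are `λ`-spread (`m_{ST}(i,j) ≤ λ|S||T|/n`, `m_{TU}(j,k) ≤ λ|T||U|/n`,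
`m_{US}(k,i) ≤ λ|U||S|/n` for all cells), with `N = |S||T||U|`, `α = |S||T|`, `β = |T||U|`, `γ = |U||S|`,
`L_x = (1 + log n)·log(4n·n!/x)`:
`2N - 2(n-1)·N·((100λ/n)·√(100λ/n)·√(L_α·L_β·L_γ)) ≤ n! + n!·√(n!)/√(n(n-1)/6)`. [folklore] -/
theorem spreadTriple_nearWall (n : ℕ) (hn : 40 ≤ n) (S T U : Finset (Equiv.Perm (Fin n)))
    (hTPP : TripleProductProperty S T U)
    (hS : ∀ s ∈ S, ∀ s' ∈ S, Equiv.Perm.sign s = Equiv.Perm.sign s')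
    (hT : ∀ t ∈ T, ∀ t' ∈ T, Equiv.Perm.sign t = Equiv.Perm.sign t')
    (hU : ∀ u ∈ U, ∀ u' ∈ U, Equiv.Perm.sign u = Equiv.Perm.sign u')
    (lam : ℝ) (hlam : 1 ≤ lam)
    (hA : ∀ i j : Fin n, (((S ×ˢ T).filter fun st => st.2 j = st.1 i).card : ℝ) ≤ lam * (S.card * T.card : ℕ) / n)
    (hB : ∀ i j : Fin n, (((T ×ˢ U).filter fun tu => tu.2 j = tu.1 i).card : ℝ) ≤ lam * (T.card * U.card : ℕ) / n)
    (hC : ∀ i j : Fin n, (((U ×ˢ S).filter fun us => us.2 j = us.1 i).card : ℝ) ≤ lam * (U.card * S.card : ℕ) / n) :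
    2 * ((S.card * T.card * U.card : ℕ) : ℝ) -
        2 * ((n : ℝ) - 1) * ((S.card * T.card * U.card : ℕ) : ℝ) *
          ((100 * lam / n) * Real.sqrt (100 * lam / n) *
            Real.sqrt (((1 + Real.log n) * Real.log (4 * n * n.factorial / (S.card * T.card : ℕ))) *
              ((1 + Real.log n) * Real.log (4 * n * n.factorial / (T.card * U.card : ℕ))) *
              ((1 + Real.log n) * Real.log (4 * n * n.factorial / (U.card * S.card : ℕ))))) ≤
      (n.factorial : ℝ) + (n.factorial : ℝ) * Real.sqrt (n.factorial : ℝ) / Real.sqrt (((n * (n - 1) : ℕ) : ℝ) / 6) := by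
  classical
  set N : ℕ := S.card * T.card * U.card with hN
  set P : ℝ := ((S.card * T.card * U.card : ℕ) : ℝ) with hP
  have hF0 : (0 : ℝ) < n.factorial := by exact_mod_cast n.factorial_pos
  have hn0 : n ≠ 0 := by omega
  have hn1 : 1 ≤ n := by omega
  have hnR : (0 : ℝ) < n := by exact_mod_cast Nat.pos_of_ne_zero hn0
  have hm : (0 : ℝ) < (n : ℝ) - 1 := by
    have : (40 : ℝ) ≤ n := by exact_mod_cast hn
    linarith
  have hD0 : 0 < Real.sqrt (((n * (n - 1) : ℕ) : ℝ) / 6) := by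
    apply Real.sqrt_pos.2; apply div_pos _ (by norm_num)
    have : 0 < n * (n - 1) := Nat.mul_pos (by omega) (by omega)
    exact_mod_cast this
  -- degenerate case
  by_cases hN0 : N = 0
  · have : P = 0 := by rw [hP, ← hN, hN0, Nat.cast_zero]
    rw [this]; simp only [mul_zero, zero_mul, sub_zero]; positivity
  have hSne : S.Nonempty := Finset.card_ne_zero.1 fun h => hN0 (by simp [hN, h])
  have hTne : T.Nonempty := Finset.card_ne_zero.1 fun h => hN0 (by simp [hN, h])
  have hUne : U.Nonempty := Finset.card_ne_zero.1 fun h => hN0 (by simp [hN, h])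
  have hNpos : (0 : ℝ) < P := by rw [hP, ← hN]; exact_mod_cast Nat.pos_of_ne_zero hN0
  -- quotient sizes
  set α : ℝ := ((S.card * T.card : ℕ) : ℝ) with hα
  set β : ℝ := ((T.card * U.card : ℕ) : ℝ) with hβ
  set γ : ℝ := ((U.card * S.card : ℕ) : ℝ) with hγ
  have hα0 : 0 < α := by rw [hα]; exact_mod_cast Nat.mul_pos hSne.card_pos hTne.card_pos
  have hβ0 : 0 < β := by rw [hβ]; exact_mod_cast Nat.mul_pos hTne.card_pos hUne.card_pos
  have hγ0 : 0 < γ := by rw [hγ]; exact_mod_cast Nat.mul_pos hUne.card_pos hSne.card_pos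
  have hNsq : α * β * γ = P ^ 2 := by rw [hα, hβ, hγ, hP]; push_cast; ring
  -- injectivity of the three quotient maps
  have hinjA := injOn_quot_first hTPP hUne
  have hinjB := injOn_quot_second hTPP hSne
  have hinjC := injOn_quot_first hTPP.rotate.rotate hTne
  -- (1) the pinning and the six-fold count as a triple sum
  have hpin := levelOnePinning n hn S T U hTPP hS hT hU
  set mA : Fin n → Fin n → ℝ := fun i j => (((S ×ˢ T).filter fun st => st.2 j = st.1 i).card : ℝ) with hmA
  set mB : Fin n → Fin n → ℝ := fun i j => (((T ×ˢ U).filter fun tu => tu.2 j = tu.1 i).card : ℝ) with hmB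
  set mC : Fin n → Fin n → ℝ := fun i j => (((U ×ˢ S).filter fun us => us.2 j = us.1 i).card : ℝ) with hmC
  have hT3 : ((∑ y ∈ ((S ×ˢ T) ×ˢ (T ×ˢ U)) ×ˢ (U ×ˢ S),
      (Finset.univ.filter fun p : Fin n =>
        (y.1.1.1⁻¹ * y.1.1.2 * (y.1.2.1⁻¹ * y.1.2.2) * (y.2.1⁻¹ * y.2.2)) p = p).card : ℕ) : ℝ) =
      ∑ i : Fin n, ∑ j : Fin n, ∑ k : Fin n, mA i j * mB j k * mC k i := by
    rw [sixFoldFix_eq_tripleSum S T U]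
    push_cast
    refine Finset.sum_congr rfl fun i _ => ?_
    rw [Finset.sum_comm]
    refine Finset.sum_congr rfl fun j _ => Finset.sum_congr rfl fun k _ => ?_
    simp only [hmA, hmB, hmC]; ring
  -- (2) normalised arrays and the centring identity
  set a : Fin n → Fin n → ℝ := fun i j => mA i j / α with ha
  set b : Fin n → Fin n → ℝ := fun i j => mB i j / β with hb
  set c : Fin n → Fin n → ℝ := fun i j => mC i j / γ with hc
  have hsndA : ∀ i, ∑ j : Fin n, mA i j = α := fun i => by
    have h : ∑ j : Fin n, ((((S ×ˢ T).filter fun st => st.2 j = st.1 i).card : ℕ) : ℝ) =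
        ((S.card * T.card : ℕ) : ℝ) := by exact_mod_cast sum_pairMarginal_snd S T i
    exact h
  have hsndB : ∀ i, ∑ j : Fin n, mB i j = β := fun i => by
    have h : ∑ j : Fin n, ((((T ×ˢ U).filter fun tu => tu.2 j = tu.1 i).card : ℕ) : ℝ) =
        ((T.card * U.card : ℕ) : ℝ) := by exact_mod_cast sum_pairMarginal_snd T U i
    exact h
  have hfstB : ∀ j, ∑ i : Fin n, mB i j = β := fun j => by
    have h : ∑ i : Fin n, ((((T ×ˢ U).filter fun tu => tu.2 j = tu.1 i).card : ℕ) : ℝ) =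
        ((T.card * U.card : ℕ) : ℝ) := by exact_mod_cast sum_pairMarginal_fst T U j
    exact h
  have hsndC : ∀ i, ∑ j : Fin n, mC i j = γ := fun i => by
    have h : ∑ j : Fin n, ((((U ×ˢ S).filter fun us => us.2 j = us.1 i).card : ℕ) : ℝ) =
        ((U.card * S.card : ℕ) : ℝ) := by exact_mod_cast sum_pairMarginal_snd U S i
    exact h
  have hfstC : ∀ j, ∑ i : Fin n, mC i j = γ := fun j => by
    have h : ∑ i : Fin n, ((((U ×ˢ S).filter fun us => us.2 j = us.1 i).card : ℕ) : ℝ) =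
        ((U.card * S.card : ℕ) : ℝ) := by exact_mod_cast sum_pairMarginal_fst U S j
    exact h
  have har : ∀ i, ∑ j : Fin n, a i j = 1 := fun i => by
    simp only [ha]; rw [← Finset.sum_div, div_eq_one_iff_eq hα0.ne', hsndA]
  have hbr : ∀ j, ∑ k : Fin n, b j k = 1 := fun j => by
    simp only [hb]; rw [← Finset.sum_div, div_eq_one_iff_eq hβ0.ne', hsndB]
  have hbc : ∀ k, ∑ j : Fin n, b j k = 1 := fun k => by
    simp only [hb]; rw [← Finset.sum_div, div_eq_one_iff_eq hβ0.ne', hfstB]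
  have hcr : ∀ k, ∑ i : Fin n, c k i = 1 := fun k => by
    simp only [hc]; rw [← Finset.sum_div, div_eq_one_iff_eq hγ0.ne', hsndC]
  have hcc : ∀ i, ∑ k : Fin n, c k i = 1 := fun i => by
    simp only [hc]; rw [← Finset.sum_div, div_eq_one_iff_eq hγ0.ne', hfstC]
  have hcen := centered_tripleSum_eq hn0 a b c har hbr hbc hcr hcc
  have habc : ∑ i : Fin n, ∑ j : Fin n, ∑ k : Fin n, a i j * b j k * c k i =
      (∑ i : Fin n, ∑ j : Fin n, ∑ k : Fin n, mA i j * mB j k * mC k i) / (α * β * γ) := by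
    rw [Finset.sum_div]
    refine Finset.sum_congr rfl fun i _ => ?_
    rw [Finset.sum_div]
    refine Finset.sum_congr rfl fun j _ => ?_
    rw [Finset.sum_div]
    refine Finset.sum_congr rfl fun k _ => ?_
    simp only [ha, hb, hc]
    field_simp
  -- (3) Frobenius bound for the centred arrays: `-Σxyz = Σ(-x)yz ≤ ‖x‖‖y‖‖z‖`
  have hfrob := tripleSum_le_norms (fun i j => -(a i j - 1 / n)) (fun j k => b j k - 1 / n)
    (fun k i => c k i - 1 / n)
  have hneg : -(∑ i : Fin n, ∑ j : Fin n, ∑ k : Fin n, (a i j - 1 / n) * (b j k - 1 / n) * (c k i - 1 / n)) ≤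
      Real.sqrt (∑ i : Fin n, ∑ j : Fin n, (a i j - 1 / n) ^ 2) *
        Real.sqrt (∑ j : Fin n, ∑ k : Fin n, (b j k - 1 / n) ^ 2) *
          Real.sqrt (∑ k : Fin n, ∑ i : Fin n, (c k i - 1 / n) ^ 2) := by
    have e1 : -(∑ i : Fin n, ∑ j : Fin n, ∑ k : Fin n, (a i j - 1 / n) * (b j k - 1 / n) * (c k i - 1 / n)) =
        ∑ i : Fin n, ∑ j : Fin n, ∑ k : Fin n, -(a i j - 1 / n) * (b j k - 1 / n) * (c k i - 1 / n) := by
      rw [← Finset.sum_neg_distrib]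
      refine Finset.sum_congr rfl fun i _ => ?_
      rw [← Finset.sum_neg_distrib]
      refine Finset.sum_congr rfl fun j _ => ?_
      rw [← Finset.sum_neg_distrib]
      refine Finset.sum_congr rfl fun k _ => ?_
      ring
    have e2 : ∑ i : Fin n, ∑ j : Fin n, (-(a i j - 1 / n)) ^ 2 = ∑ i : Fin n, ∑ j : Fin n, (a i j - 1 / n) ^ 2 :=
      Finset.sum_congr rfl fun i _ => Finset.sum_congr rfl fun j _ => by ring
    rw [e1]; rw [e2] at hfrob; exact hfrob
  -- spread bounds for the three centred arrays
  have hPA := Real.sqrt_le_sqrt (sumSq_centered_pair_le_spread hn1 hSne hTne hinjA lam hlam hA)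
  have hPB := Real.sqrt_le_sqrt (sumSq_centered_pair_le_spread hn1 hTne hUne hinjB lam hlam hB)
  have hPC := Real.sqrt_le_sqrt (sumSq_centered_pair_le_spread hn1 hUne hSne hinjC lam hlam hC)
  rw [← hα] at hPA
  rw [← hβ] at hPB
  rw [← hγ] at hPC
  change Real.sqrt (∑ i : Fin n, ∑ j : Fin n, (a i j - 1 / n) ^ 2) ≤ _ at hPA
  change Real.sqrt (∑ i : Fin n, ∑ j : Fin n, (b i j - 1 / n) ^ 2) ≤ _ at hPB
  change Real.sqrt (∑ i : Fin n, ∑ j : Fin n, (c i j - 1 / n) ^ 2) ≤ _ at hPC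
  have hG0 : 0 ≤ 1 + Real.log n := by
    have := Real.log_nonneg (show (1 : ℝ) ≤ n by exact_mod_cast Nat.pos_of_ne_zero hn0); linarith
  -- the logs are non-negative (`α, β, γ ≤ n!`)
  have hlog : ∀ {X Y : Finset (Equiv.Perm (Fin n))}, X.Nonempty → Y.Nonempty →
      Set.InjOn (fun xy : Equiv.Perm (Fin n) × Equiv.Perm (Fin n) => xy.1⁻¹ * xy.2)
        (↑X ×ˢ ↑Y : Set (Equiv.Perm (Fin n) × Equiv.Perm (Fin n))) →
      0 ≤ Real.log (4 * n * (n.factorial : ℝ) / (X.card * Y.card : ℕ)) := by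
    intro X Y hX hY hinj
    apply Real.log_nonneg
    have hcd : (0 : ℝ) < (X.card * Y.card : ℕ) := by exact_mod_cast Nat.mul_pos hX.card_pos hY.card_pos
    rw [le_div_iff₀ hcd]
    have h1 : ((X.card * Y.card : ℕ) : ℝ) ≤ n.factorial := by
      exact_mod_cast card_mul_card_le_factorial_of_injOn hinj
    nlinarith
  set LA : ℝ := (1 + Real.log n) * Real.log (4 * n * (n.factorial : ℝ) / α) with hLA
  set LB : ℝ := (1 + Real.log n) * Real.log (4 * n * (n.factorial : ℝ) / β) with hLB
  set LC : ℝ := (1 + Real.log n) * Real.log (4 * n * (n.factorial : ℝ) / γ) with hLC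
  have hLA0 : 0 ≤ LA := by rw [hLA, hα]; exact mul_nonneg hG0 (hlog hSne hTne hinjA)
  have hLB0 : 0 ≤ LB := by rw [hLB, hβ]; exact mul_nonneg hG0 (hlog hTne hUne hinjB)
  have hLC0 : 0 ≤ LC := by rw [hLC, hγ]; exact mul_nonneg hG0 (hlog hUne hSne hinjC)
  set q : ℝ := 100 * lam / n with hq
  have hq0 : 0 ≤ q := by rw [hq]; positivity
  -- rewrite the three bounds as `√(q·L)`
  have hPA' : Real.sqrt (∑ i : Fin n, ∑ j : Fin n, (a i j - 1 / n) ^ 2) ≤ Real.sqrt (q * LA) := by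
    refine hPA.trans (le_of_eq ?_); congr 1; rw [hq, hLA]; ring
  have hPB' : Real.sqrt (∑ i : Fin n, ∑ j : Fin n, (b i j - 1 / n) ^ 2) ≤ Real.sqrt (q * LB) := by
    refine hPB.trans (le_of_eq ?_); congr 1; rw [hq, hLB]; ring
  have hPC' : Real.sqrt (∑ i : Fin n, ∑ j : Fin n, (c i j - 1 / n) ^ 2) ≤ Real.sqrt (q * LC) := by
    refine hPC.trans (le_of_eq ?_); congr 1; rw [hq, hLC]; ring
  have hprod : Real.sqrt (∑ i : Fin n, ∑ j : Fin n, (a i j - 1 / n) ^ 2) *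
      Real.sqrt (∑ j : Fin n, ∑ k : Fin n, (b j k - 1 / n) ^ 2) *
        Real.sqrt (∑ k : Fin n, ∑ i : Fin n, (c k i - 1 / n) ^ 2) ≤
      q * Real.sqrt q * Real.sqrt (LA * LB * LC) := by
    calc Real.sqrt (∑ i : Fin n, ∑ j : Fin n, (a i j - 1 / n) ^ 2) *
          Real.sqrt (∑ j : Fin n, ∑ k : Fin n, (b j k - 1 / n) ^ 2) *
            Real.sqrt (∑ k : Fin n, ∑ i : Fin n, (c k i - 1 / n) ^ 2)
        ≤ Real.sqrt (q * LA) * Real.sqrt (q * LB) * Real.sqrt (q * LC) :=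
          mul_le_mul (mul_le_mul hPA' hPB' (Real.sqrt_nonneg _) (Real.sqrt_nonneg _)) hPC'
            (Real.sqrt_nonneg _) (by positivity)
      _ = q * Real.sqrt q * Real.sqrt (LA * LB * LC) := by
          rw [← Real.sqrt_mul (mul_nonneg hq0 hLA0), ← Real.sqrt_mul (by positivity)]
          have e : q * LA * (q * LB) * (q * LC) = (q * q) * (q * (LA * LB * LC)) := by ring
          rw [e, Real.sqrt_mul (mul_nonneg hq0 hq0), Real.sqrt_mul_self hq0,
            Real.sqrt_mul hq0]
          ring
  -- (4) assemble
  have hmain : 2 * ((n : ℝ) - 1) * (P ^ 2 -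
      ∑ i : Fin n, ∑ j : Fin n, ∑ k : Fin n, mA i j * mB j k * mC k i) =
      2 * ((n : ℝ) - 1) * P ^ 2 *
        (-(∑ i : Fin n, ∑ j : Fin n, ∑ k : Fin n, (a i j - 1 / n) * (b j k - 1 / n) * (c k i - 1 / n))) := by
    have hP2 : P ^ 2 ≠ 0 := pow_ne_zero 2 hNpos.ne'
    rw [hcen, habc, hNsq]
    field_simp
    ring
  rw [hT3, Nat.cast_pow, ← hP] at hpin
  have h2 : 2 * ((n : ℝ) - 1) * P ^ 2 *
      (-(∑ i : Fin n, ∑ j : Fin n, ∑ k : Fin n, (a i j - 1 / n) * (b j k - 1 / n) * (c k i - 1 / n))) ≤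
      2 * ((n : ℝ) - 1) * P ^ 2 * (q * Real.sqrt q * Real.sqrt (LA * LB * LC)) :=
    mul_le_mul_of_nonneg_left (hneg.trans hprod) (by positivity)
  have hfin : 2 * P ^ 2 - (n.factorial : ℝ) * P -
      P * ((n.factorial : ℝ) * Real.sqrt (n.factorial : ℝ)) / Real.sqrt (((n * (n - 1) : ℕ) : ℝ) / 6) ≤
      2 * ((n : ℝ) - 1) * P ^ 2 * (q * Real.sqrt q * Real.sqrt (LA * LB * LC)) := by
    have := hpin.trans (le_of_eq hmain)
    linarith
  -- divide by `P > 0`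
  have hdiv : 2 * P - (n.factorial : ℝ) -
      ((n.factorial : ℝ) * Real.sqrt (n.factorial : ℝ)) / Real.sqrt (((n * (n - 1) : ℕ) : ℝ) / 6) ≤
      2 * ((n : ℝ) - 1) * P * (q * Real.sqrt q * Real.sqrt (LA * LB * LC)) := by
    have e : P * (2 * P - (n.factorial : ℝ) -
        ((n.factorial : ℝ) * Real.sqrt (n.factorial : ℝ)) / Real.sqrt (((n * (n - 1) : ℕ) : ℝ) / 6)) =
        2 * P ^ 2 - (n.factorial : ℝ) * P -
          P * ((n.factorial : ℝ) * Real.sqrt (n.factorial : ℝ)) / Real.sqrt (((n * (n - 1) : ℕ) : ℝ) / 6) := by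
      ring
    have e2 : P * (2 * ((n : ℝ) - 1) * P * (q * Real.sqrt q * Real.sqrt (LA * LB * LC))) =
        2 * ((n : ℝ) - 1) * P ^ 2 * (q * Real.sqrt q * Real.sqrt (LA * LB * LC)) := by ring
    have h' : P * (2 * P - (n.factorial : ℝ) -
        ((n.factorial : ℝ) * Real.sqrt (n.factorial : ℝ)) / Real.sqrt (((n * (n - 1) : ℕ) : ℝ) / 6)) ≤
        P * (2 * ((n : ℝ) - 1) * P * (q * Real.sqrt q * Real.sqrt (LA * LB * LC))) := by
      rw [e, e2]; exact hfin
    exact le_of_mul_le_mul_left h' hNpos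
  rw [hLA, hLB, hLC, hα, hβ, hγ] at hdiv
  linarith [hdiv]

end Summit.MatrixMultiplication.MatrixMultiplication.Theorems.PolynomialSlack
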